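import Literature.MathematicalPhysics.QuantumFieldTheory.Balaban1983to89.Node00.BgLettersOfRecord
import HarnessLib

/-!
# NODE N07 — DEFINITIONS: THE FIBREWISE SCALAR PART `scalPartW` OF A `WRec N`-VALUED LATTICE FIELD (the projection of `M_N(ℂ) = 𝔰𝔩_N ⊕ ℂ·1` onto `ℂ·1`, bondwise ∕ sitewise,
# read through the record's fibre identification `φ = phiRec N`) — the letter in which the TRACE half of def-Y's rows is stated: a linear letter `L` «respects the trace sectors»
# iff it commutes with `scalPartW` ([15] (51) p. 286 «for A′ with values in 𝔤 the configuration D(A′) has values in 𝔤 also»; [B9] p. 391 «functions with values in N × N hermitian matrices»)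

Cell `pub-ymgap`, width seat `pub-ymgap-dag-n07-w3` (g26), CLAIM-17 (Defs).  `--kind definition --supports stmt-QuantumFields-27238 --as helper`; count-neutral.  The route-posited object of this
seat's trace-sector files (✓`…N07CurvFormTraceSU2`, `…N07HessOpTraceSU2`, `…N07RecordLettersTraceSectors`, and the projection∕inverse files to come), declared ONCE here; consumers:
`…N07TraceSectorProjection` (next).  [15] = [Balaban1985Variational]; [B9] = [Balaban1985BackgroundPropagators].

CONTENTS.  `scalPartW N w : WL2 ℂ w (WRec N) →ₗ[ℂ] WL2 ℂ w (WRec N)` — `(scalPartW f)(i) := φ⁻¹((N⁻¹·tr φ(f i))·1)`; unfolding lemmas `equiv_scalPartW`, `phiRec_equiv_scalPartW`.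

HONEST FRAMING.  A definition and two `rfl`-level lemmas; nothing of Bałaban is asserted; count-neutral; N07 NOT discharged; P0 ⟨26900⟩ OPEN; R4 is the conditional finite-𝕋⁴ rung only.
Nothing here is a claim about the Yang–Mills mass gap (`Summit.QuantumFields`): finite torus, fixed `ε`; nothing continuum ∕ OS ∕ Clay.
-/

set_option autoImplicit false

noncomputable section

open scoped Matrix BigOperators

namespace Summit.QuantumFields.YangMills.Theorems.N07TraceSectorDefs

open Literature.MathematicalPhysics.QuantumFieldTheory.Balaban1983to89
open B9Eq311L2Pairing (WL2)
open Node00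

variable (N : ℕ) {ι : Type*} (w : ι → ℝ)

/-- **THE FIBREWISE SCALAR PART** of a `WRec N`-valued lattice field, read through `φ = phiRec N`: `(scalPartW f)(i) = φ⁻¹((N⁻¹·tr φ(f i))·1)` — the projection of
`M_N(ℂ) = 𝔰𝔩_N ⊕ ℂ·1` onto the scalars, applied pointwise (for `N = 0` it is `0`).  A field is TRACELESS-valued iff its scalar part vanishes, SCALAR-valued iff it equals its scalar
part (`…N07TraceSectorProjection`). [cite: Balaban1985Variational, (51) p.286; Balaban1985BackgroundPropagators, p.391] -/
def scalPartW : WL2 ℂ w (WRec N) →ₗ[ℂ] WL2 ℂ w (WRec N) where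
  toFun f := (WL2.equiv ℂ w (WRec N)).symm fun i =>
    (phiRec N).symm ((((N : ℂ))⁻¹ * (phiRec N (WL2.equiv ℂ w (WRec N) f i)).trace) • (1 : Matrix (Fin N) (Fin N) ℂ))
  map_add' f g := by
    apply (WL2.equiv ℂ w (WRec N)).injective
    funext i
    simp only [Equiv.apply_symm_apply, WL2.equiv_add, Pi.add_apply, map_add, Matrix.trace_add, mul_add, add_smul]
  map_smul' c f := by
    apply (WL2.equiv ℂ w (WRec N)).injective
    funext i
    simp only [Equiv.apply_symm_apply, WL2.equiv_smul, Pi.smul_apply, map_smul, Matrix.trace_smul, RingHom.id_apply, smul_eq_mul, ← smul_smul]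
    rw [smul_comm]

/-- Unfolding: the value of the scalar part at `i`. [cite: Balaban1985Variational, (51) p.286 (bookkeeping)] -/
@[simp] theorem equiv_scalPartW (f : WL2 ℂ w (WRec N)) (i : ι) :
    WL2.equiv ℂ w (WRec N) (scalPartW N w f) i = (phiRec N).symm ((((N : ℂ))⁻¹ * (phiRec N (WL2.equiv ℂ w (WRec N) f i)).trace) • (1 : Matrix (Fin N) (Fin N) ℂ)) :=
  rfl

/-- Unfolding, read in the matrices: `φ((scalPartW f)(i)) = (N⁻¹·tr φ(f i))·1`. [cite: Balaban1985Variational, (51) p.286 (bookkeeping)] -/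
theorem phiRec_equiv_scalPartW (f : WL2 ℂ w (WRec N)) (i : ι) :
    phiRec N (WL2.equiv ℂ w (WRec N) (scalPartW N w f) i) = (((N : ℂ))⁻¹ * (phiRec N (WL2.equiv ℂ w (WRec N) f i)).trace) • (1 : Matrix (Fin N) (Fin N) ℂ) := by
  rw [equiv_scalPartW, LinearEquiv.apply_symm_apply]

end Summit.QuantumFields.YangMills.Theorems.N07TraceSectorDefs

end
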